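import Mathlib
import Literature.AlgebraicGeometry.Resolution.FormalInverseFunction
import Literature.RingTheory.MvPowerSeries.MaximalIdealPow
import Literature.RingTheory.MvPowerSeries.DiagonalForms
import Summits.ResolutionOfSingularities.ResolutionOfSingularities.Theorems.WeightedConstruction.Negative.K1WildOrbitFaceField
import Summits.ResolutionOfSingularities.ResolutionOfSingularities.Theorems.WeightedInvariantLocalWeightedDropTwistedTrivialTransportPrep

/-!
# `HypersurfaceCentreConstruction` door, (o50-c): THE K1 CERTIFICATE, piece (C2) — the flag-free contact bound at the wild orbit

Route `ResolutionOfSingularities/WeightedInvariant`, door `HypersurfaceCentreConstruction` (stmt-ResolutionOfSingularities-19897),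
P3 rung, (c9′)≤3 at WILD weights; res-L1-w43-plan-1 ORDER (o50) (holder res-type-060, memo `plan/tools/res-type-060/o50/K-WILD-HOM.md`
§4) and DEAL NOTE 2026-08-27T14:43:42Z «(o50-c) the K1 certificate as res-type-060's co-hand → res-type-099»; split of record
(res-type-060 14:53:27Z / res-type-099 14:53:59Z): (C1) = 060's flag-general structure lemma
`flagContactFiltration g₁ g₂ q r₁ r₂ (2r₁) ≤ (g₁²) + g₁·𝔪³ + 𝔪⁵` (`q ≤ r₂`, `2r₂ < r₁`); **(C2) = THIS FILE**.  [OURS · L1 W4.3] —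
res-type-099 (gen 13).  The coefficient core is res-L1-w43-tri-1's (`…Negative.K1WildOrbitFace(Field)`, p538148: `face_coeff_ne_zero`,
`not_isSquare_ratFuncX`), imported, not restated.  Nothing here is a statement of the manuscript under review on ladder RESOLUTION;
AI-produced, weaker than expert review.

THE CERTIFICATE (`k1_not_mem_span_sup_pow`).  In the completed model `κ⟦T, X, Z⟧` (`T = X 0`, `X = X 1`, `Z = X 2`) of the local ring
at the unique T-homogeneous successor prime `η = (T, X, Z)` of Hauser's K1 `x² + y⁷ + yz⁴` blown up with the exact σ-weights `(5,2,2)`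
(memo §4: chart germ `g = X² + Y·Z⁴ + Y⁷·T⁴`, residue field `κ(η) = 𝔽₂(Y)`, `Y` a unit and NOT A SQUARE), with `char κ = 2` and `y ∈ κ` a
non-square: for EVERY regular parameter `g₁ ∈ 𝔪 ∖ 𝔪²` and every tail `ρ ∈ 𝔪⁵` (K1′ = K1 + z⁹ contributes `T⁸Z⁹ ∈ 𝔪⁵`; any cleaning
tail likewise), `X² + y·Z⁴ + y⁷·T⁴ + ρ ∉ (g₁) + 𝔪⁵`.  With (C1) this gives `¬ FlagReaches g 2 q r₁ r₂` for every two-flag and every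
admissible triple with `2r₂ < r₁` — no flag, homogeneous or not, beats the ratio `2` reached by `(X, Z)`: σ₁ drops `5 → 4` at `η`
(memo §4 «(K) HOLDS at K1»; res-L1-w43-tri-1 TRIAGE v9.7 §21.15 (D)/(E) reaches the same by hand).

PROOF.  Write `g = c·g₁ + ρ′`, `ρ′ ∈ 𝔪⁵`.  (A) If `∂g₁/∂X(0) ≠ 0`: the frame `(T, g₁, Z)` is a formal coordinate change; its inverse
(`FormalCoordChange.exists_comp_inverse`, the tree's formal inverse function theorem) followed by `X ↦ 0` is a substitution
`Ψ : κ⟦T,X,Z⟧ → κ⟦z,u⟧` (`T ↦ u`, `Z ↦ z`, `X ↦ φ(z,u)`) KILLING `g₁` and mapping `𝔪⁵` into `𝔪⁵` (`subst_mem_maximalIdeal_pow`); the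
`z⁴`-coefficient of `Ψ g = φ² + y z⁴ + y⁷ u⁴ + Ψρ` is `(φ_{z²})² + y ≠ 0` (`face_coeff_ne_zero`) but that of `Ψρ′` is `0`.  (B) If
`∂g₁/∂X(0) = 0`: some other linear coefficient of `g₁` is non-zero, the degree-one layer of `g = c·g₁ + ρ′` gives `c(0) = 0`, and then
the `X²`-coefficient of `c·g₁ + ρ′` vanishes while that of `g` is `1`.
-/

set_option linter.dupNamespace false -- mandated namespace of this single-conjunct summit
set_option autoImplicit false

namespace Summit.ResolutionOfSingularities.ResolutionOfSingularities.Theorems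

namespace K1Cert

open MvPowerSeries IsLocalRing
open Literature.RingTheory.MvPowerSeries.Jets
open Literature.AlgebraicGeometry.Resolution.FormalCoordChange (linMat exists_comp_inverse)
open WeightedConstruction.Negative.K1WildOrbitFace (face_coeff_ne_zero)
open WeightedConstruction.Negative.K1WildOrbitFaceField (not_isSquare_ratFuncX)

variable {κ : Type} [Field κ]

/-! ## Substitutions respect powers of the maximal ideal -/

/-- A substitution by series without constant terms maps `𝔪^N` into `𝔪^N` (orders do not drop: Mathlib's `le_order_subst`).
[folklore] -/
theorem subst_mem_maximalIdeal_pow {n m : ℕ} (a : Fin n → MvPowerSeries (Fin m) κ) (ha : ∀ i, constantCoeff (a i) = 0)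
    {N : ℕ} {f : MvPowerSeries (Fin n) κ} (hf : f ∈ maximalIdeal (MvPowerSeries (Fin n) κ) ^ N) :
    subst a f ∈ maximalIdeal (MvPowerSeries (Fin m) κ) ^ N := by
  have has : HasSubst a := hasSubst_of_constantCoeff_zero ha
  rw [← le_order_iff_mem_maximalIdeal_pow] at hf ⊢
  refine le_trans ?_ (le_order_subst has f)
  have h1 : (1 : ℕ∞) ≤ ⨅ i, (a i).order :=
    le_iInf fun i => mem_maximalIdeal_iff_one_le_order.mp (mem_maximalIdeal_iff_constantCoeff_eq_zero.mpr (ha i))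
  exact le_trans hf (le_mul_of_one_le_left bot_le h1)

/-! ## Low-degree coefficients of the K1 germ -/

/-- The K1 germ (plus any tail in `𝔪⁵`) has no linear terms. [OURS · L1 W4.3] -/
theorem coeff_single_one_k1 (y : κ) (ρ : MvPowerSeries (Fin 3) κ) (hρ : ρ ∈ maximalIdeal (MvPowerSeries (Fin 3) κ) ^ 5)
    (i : Fin 3) :
    coeff (Finsupp.single i 1) ((X 1 : MvPowerSeries (Fin 3) κ) ^ 2 + C y * X 2 ^ 4 + C (y ^ 7) * X 0 ^ 4 + ρ) = 0 := by
  have h4 : ∀ s : Fin 3, (Finsupp.single i 1 : Fin 3 →₀ ℕ) ≠ Finsupp.single s 4 := by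
    intro s h; have := congrArg Finsupp.degree h; simp [Finsupp.degree_single] at this
  have h2 : (Finsupp.single i 1 : Fin 3 →₀ ℕ) ≠ Finsupp.single 1 2 := by
    intro h; have := congrArg Finsupp.degree h; simp [Finsupp.degree_single] at this
  rw [map_add, map_add, map_add, coeff_eq_zero_of_mem_maximalIdeal_pow hρ (by simp [Finsupp.degree_single]),
    X_pow_eq, X_pow_eq, X_pow_eq, coeff_monomial, if_neg h2, coeff_C_mul, coeff_C_mul, coeff_monomial, coeff_monomial,
    if_neg (h4 2), if_neg (h4 0)]
  ring

/-- The `X²`-coefficient of the K1 germ (plus any tail in `𝔪⁵`) is `1`. [OURS · L1 W4.3] -/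
theorem coeff_X_sq_k1 (y : κ) (ρ : MvPowerSeries (Fin 3) κ) (hρ : ρ ∈ maximalIdeal (MvPowerSeries (Fin 3) κ) ^ 5) :
    coeff (Finsupp.single 1 2) ((X 1 : MvPowerSeries (Fin 3) κ) ^ 2 + C y * X 2 ^ 4 + C (y ^ 7) * X 0 ^ 4 + ρ) = 1 := by
  have h4 : ∀ s : Fin 3, (Finsupp.single 1 2 : Fin 3 →₀ ℕ) ≠ Finsupp.single s 4 := by
    intro s h; have := congrArg Finsupp.degree h; simp [Finsupp.degree_single] at this
  rw [map_add, map_add, map_add, coeff_eq_zero_of_mem_maximalIdeal_pow hρ (by simp [Finsupp.degree_single]),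
    X_pow_eq, X_pow_eq, X_pow_eq, coeff_monomial, if_pos rfl, coeff_C_mul, coeff_C_mul, coeff_monomial, coeff_monomial,
    if_neg (h4 2), if_neg (h4 0)]
  ring

/-! ## Degree-one and degree-two layers of a product -/

/-- Linear coefficients of a product `c · g₁` with `g₁(0) = 0`: `c(0) · (g₁)ᵢ`. [folklore] -/
theorem coeff_single_one_mul {m : ℕ} (c g₁ : MvPowerSeries (Fin m) κ) (h₁ : constantCoeff g₁ = 0) (i : Fin m) :
    coeff (Finsupp.single i 1) (c * g₁) = constantCoeff c * coeff (Finsupp.single i 1) g₁ := by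
  classical
  rw [coeff_mul, Finsupp.antidiagonal_single, Finset.sum_map, Finset.Nat.antidiagonal_succ, Finset.sum_cons,
    Finset.sum_map, Finset.Nat.antidiagonal_zero, Finset.sum_singleton]
  simp [h₁]

/-- The `xᵢ²`-coefficient of `c · g₁` VANISHES when `c(0) = 0`, `g₁(0) = 0` and `∂g₁/∂xᵢ(0) = 0`. [folklore] -/
theorem coeff_single_two_mul_eq_zero {m : ℕ} (c g₁ : MvPowerSeries (Fin m) κ) (hc : constantCoeff c = 0)
    (h₁ : constantCoeff g₁ = 0) (i : Fin m) (hlam : coeff (Finsupp.single i 1) g₁ = 0) :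
    coeff (Finsupp.single i 2) (c * g₁) = 0 := by
  classical
  rw [coeff_mul, Finsupp.antidiagonal_single, Finset.sum_map]
  refine Finset.sum_eq_zero fun p hp => ?_
  rw [Finset.HasAntidiagonal.mem_antidiagonal] at hp
  simp only [Function.Embedding.coe_prodMap, Function.Embedding.coeFn_mk, Prod.map_fst, Prod.map_snd]
  rcases Nat.lt_or_ge p.1 1 with h0 | h0
  · have : p.1 = 0 := by omega
    rw [this, Finsupp.single_zero, coeff_zero_eq_constantCoeff_apply, hc, zero_mul]
  · rcases Nat.lt_or_ge p.1 2 with h1' | h1'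
    · have hp1 : p.1 = 1 := by omega
      have hp2 : p.2 = 1 := by omega
      rw [hp1, hp2, hlam, mul_zero]
    · have hp2 : p.2 = 0 := by omega
      rw [hp2, Finsupp.single_zero, coeff_zero_eq_constantCoeff_apply, h₁, mul_zero]

/-! ## Case (B): `∂g₁/∂X(0) = 0` -/

/-- Case (B) of the certificate: if `g₁ ∈ 𝔪 ∖ 𝔪²` has no `X`-linear term, `X² + y Z⁴ + y⁷ T⁴ + ρ ≠ c·g₁ + ρ′` for all `c` and all
`ρ, ρ′ ∈ 𝔪⁵`. [OURS · L1 W4.3] -/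
theorem k1_ne_of_coeff_X_eq_zero (y : κ) (g₁ c ρ ρ' : MvPowerSeries (Fin 3) κ) (h₁ : constantCoeff g₁ = 0)
    (hlam : coeff (Finsupp.single 1 1) g₁ = 0) (hlin : ∃ i, coeff (Finsupp.single i 1) g₁ ≠ 0)
    (hρ : ρ ∈ maximalIdeal (MvPowerSeries (Fin 3) κ) ^ 5) (hρ' : ρ' ∈ maximalIdeal (MvPowerSeries (Fin 3) κ) ^ 5) :
    (X 1 : MvPowerSeries (Fin 3) κ) ^ 2 + C y * X 2 ^ 4 + C (y ^ 7) * X 0 ^ 4 + ρ ≠ c * g₁ + ρ' := by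
  intro h
  obtain ⟨i, hi⟩ := hlin
  -- degree one: `c(0) = 0`
  have hc : constantCoeff c = 0 := by
    have e1 := congrArg (coeff (Finsupp.single i 1)) h
    rw [coeff_single_one_k1 y ρ hρ i, map_add, coeff_single_one_mul c g₁ h₁ i,
      coeff_eq_zero_of_mem_maximalIdeal_pow hρ' (by simp [Finsupp.degree_single]), add_zero] at e1
    exact (mul_eq_zero.mp e1.symm).resolve_right hi
  -- degree two at `X²`: `1 = 0`
  have e2 := congrArg (coeff (Finsupp.single 1 2)) h
  rw [coeff_X_sq_k1 y ρ hρ, map_add, coeff_single_two_mul_eq_zero c g₁ hc h₁ 1 hlam,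
    coeff_eq_zero_of_mem_maximalIdeal_pow hρ' (by simp [Finsupp.degree_single]), add_zero] at e2
  exact one_ne_zero e2

/-! ## Case (A): `∂g₁/∂X(0) ≠ 0` — the implicit-function substitution -/

/-- Case (A) of the certificate (`char κ = 2`, `y` not a square): if `∂g₁/∂X(0) ≠ 0`, `X² + y Z⁴ + y⁷ T⁴ + ρ ≠ c·g₁ + ρ′` for all `c`
and all `ρ, ρ′ ∈ 𝔪⁵`. [OURS · L1 W4.3] -/
theorem k1_ne_of_coeff_X_ne_zero [CharP κ 2] {y : κ} (hy : ¬ IsSquare y) (g₁ c ρ ρ' : MvPowerSeries (Fin 3) κ)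
    (h₁ : constantCoeff g₁ = 0) (hlam : coeff (Finsupp.single 1 1) g₁ ≠ 0)
    (hρ : ρ ∈ maximalIdeal (MvPowerSeries (Fin 3) κ) ^ 5) (hρ' : ρ' ∈ maximalIdeal (MvPowerSeries (Fin 3) κ) ^ 5) :
    (X 1 : MvPowerSeries (Fin 3) κ) ^ 2 + C y * X 2 ^ 4 + C (y ^ 7) * X 0 ^ 4 + ρ ≠ c * g₁ + ρ' := by
  classical
  intro h
  -- the frame `(T, g₁, Z)`
  set θ : Fin 3 → MvPowerSeries (Fin 3) κ := Function.update X 1 g₁ with hθ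
  have hθ1 : θ 1 = g₁ := by simp [hθ]
  have hθ0' : θ 0 = X 0 := by simp [hθ]
  have hθ2 : θ 2 = X 2 := by simp [hθ]
  have hθ0 : ∀ i, constantCoeff (θ i) = 0 := by
    intro i
    by_cases hi : i = 1
    · subst hi; rw [hθ1]; exact h₁
    · have : θ i = X i := by simp [hθ, Function.update_of_ne hi]
      rw [this]; exact constantCoeff_X _
  have hdet : IsUnit (linMat θ).det := by
    have hM : ∀ i j : Fin 3, linMat θ i j = coeff (Finsupp.single j 1) (θ i) := fun i j => rfl
    rw [Matrix.det_fin_three]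
    simp only [hM, hθ0', hθ1, hθ2, GradedGame.TwistedTransport.coeff_single_X]
    simp only [Fin.isValue, Fin.reduceEq, if_true, if_false]
    rw [isUnit_iff_ne_zero]
    ring_nf
    exact hlam
  obtain ⟨ψ, hψ0, hψθ, -⟩ := exists_comp_inverse hθ0 hdet
  have hψs : HasSubst ψ := hasSubst_of_constantCoeff_zero hψ0
  -- kill `X`: `π : T ↦ u, X ↦ 0, Z ↦ z` into `κ⟦z, u⟧` (index `0 = z`, `1 = u`, as in `K1WildOrbitFace`)
  set π : Fin 3 → MvPowerSeries (Fin 2) κ := ![X 1, 0, X 0] with hπ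
  have hπ0 : ∀ i, constantCoeff (π i) = 0 := by
    intro i; fin_cases i <;> simp [hπ, constantCoeff_X]
  have hπs : HasSubst π := hasSubst_of_constantCoeff_zero hπ0
  set Ψ : Fin 3 → MvPowerSeries (Fin 2) κ := fun i => subst π (ψ i) with hΨ
  have hΨ0 : ∀ i, constantCoeff (Ψ i) = 0 := fun i => constantCoeff_subst_eq_zero hπs hπ0 (hψ0 i)
  have hΨs : HasSubst Ψ := hasSubst_of_constantCoeff_zero hΨ0
  have hΨsub : ∀ F : MvPowerSeries (Fin 3) κ, subst Ψ F = subst π (subst ψ F) := by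
    intro F; rw [subst_comp_subst_apply hψs hπs]
  have hΨg₁ : subst Ψ g₁ = 0 := by
    rw [hΨsub, ← hθ1, hψθ 1, subst_X hπs]; simp [hπ]
  have hψ0X : ψ 0 = X 0 := by
    have h0 := hψθ 0
    rwa [hθ0', subst_X hψs] at h0
  have hψ2X : ψ 2 = X 2 := by
    have h2 := hψθ 2
    rwa [hθ2, subst_X hψs] at h2
  have hΨT : Ψ 0 = X 1 := by
    show subst π (ψ 0) = X 1
    rw [hψ0X, subst_X hπs]; simp [hπ]
  have hΨZ : Ψ 2 = X 0 := by
    show subst π (ψ 2) = X 0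
    rw [hψ2X, subst_X hπs]; simp [hπ]
  -- apply `Ψ` to `g = c·g₁ + ρ′`
  have hg : subst Ψ ((X 1 : MvPowerSeries (Fin 3) κ) ^ 2 + C y * X 2 ^ 4 + C (y ^ 7) * X 0 ^ 4 + ρ) =
      Ψ 1 ^ 2 + C y * X 0 ^ 4 + C (y ^ 7) * X 1 ^ 4 + subst Ψ ρ := by
    simp only [subst_add hΨs, subst_mul hΨs, subst_pow hΨs, subst_C, subst_X hΨs, hΨT, hΨZ]
  have hr : subst Ψ (c * g₁ + ρ') = subst Ψ ρ' := by
    rw [subst_add hΨs, subst_mul hΨs, hΨg₁, mul_zero, zero_add]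
  have e := congrArg (subst Ψ) h
  rw [hg, hr] at e
  -- compare `z⁴`-coefficients
  have hρΨ : coeff (Finsupp.single 0 4) (subst Ψ ρ) = 0 :=
    coeff_eq_zero_of_mem_maximalIdeal_pow (subst_mem_maximalIdeal_pow Ψ hΨ0 hρ) (by simp [Finsupp.degree_single])
  have hρ'Ψ : coeff (Finsupp.single 0 4) (subst Ψ ρ') = 0 :=
    coeff_eq_zero_of_mem_maximalIdeal_pow (subst_mem_maximalIdeal_pow Ψ hΨ0 hρ') (by simp [Finsupp.degree_single])
  have hne := face_coeff_ne_zero hy (Ψ 1) (subst Ψ ρ) hρΨ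
  rw [e] at hne
  exact hne hρ'Ψ

/-! ## The certificate -/

/-- **(C2) THE K1 CERTIFICATE, flag-free form** (`char κ = 2`, `y ∈ κ` not a square): for every regular parameter `g₁ ∈ 𝔪 ∖ 𝔪²` of
`κ⟦T, X, Z⟧` and every tail `ρ ∈ 𝔪⁵`, the K1 chart germ `X² + y·Z⁴ + y⁷·T⁴ + ρ` does NOT lie in `(g₁) + 𝔪⁵`.  With res-type-060's
(C1) `flagContactFiltration g₁ g₂ q r₁ r₂ (2r₁) ≤ (g₁²) + g₁·𝔪³ + 𝔪⁵ ≤ (g₁) + 𝔪⁵` (`2r₂ < r₁`): no two-flag of the completed local ring at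
the homogeneous successor `η` reaches a ratio `> 2` — σ₁ drops `5 → 4` (K-WILD-HOM memo §4). [OURS · L1 W4.3] -/
theorem k1_not_mem_span_sup_pow [CharP κ 2] {y : κ} (hy : ¬ IsSquare y) (g₁ : MvPowerSeries (Fin 3) κ)
    (h₁ : g₁ ∈ maximalIdeal (MvPowerSeries (Fin 3) κ)) (h₁' : g₁ ∉ maximalIdeal (MvPowerSeries (Fin 3) κ) ^ 2)
    (ρ : MvPowerSeries (Fin 3) κ) (hρ : ρ ∈ maximalIdeal (MvPowerSeries (Fin 3) κ) ^ 5) :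
    (X 1 : MvPowerSeries (Fin 3) κ) ^ 2 + C y * X 2 ^ 4 + C (y ^ 7) * X 0 ^ 4 + ρ ∉
      Ideal.span {g₁} ⊔ maximalIdeal (MvPowerSeries (Fin 3) κ) ^ 5 := by
  classical
  intro hmem
  obtain ⟨a, ha, ρ', hρ', hsum⟩ := Submodule.mem_sup.mp hmem
  obtain ⟨c, rfl⟩ := Ideal.mem_span_singleton'.mp ha
  have h0 : constantCoeff g₁ = 0 := mem_maximalIdeal_iff_constantCoeff_eq_zero.mp h₁
  -- `g₁ ∉ 𝔪²`: some linear coefficient is non-zero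
  have hlin : ∃ i, coeff (Finsupp.single i 1) g₁ ≠ 0 := by
    by_contra! hall
    apply h₁'
    refine mem_maximalIdeal_pow_of_coeff_eq_zero fun e he => ?_
    rcases Nat.lt_or_ge e.degree 1 with hd | hd
    · have : e = 0 := (Finsupp.degree_eq_zero_iff e).mp (by omega)
      rw [this, coeff_zero_eq_constantCoeff_apply, h0]
    · have hd1 : e.degree = 1 := by omega
      obtain ⟨i, hi⟩ := Literature.RingTheory.MvPowerSeries.DiagonalForms.exists_eq_single_of_degree_eq_one hd1
      rw [hi]; exact hall i
  by_cases hlam : coeff (Finsupp.single 1 1) g₁ = 0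
  · exact k1_ne_of_coeff_X_eq_zero y g₁ c ρ ρ' h0 hlam hlin hρ hρ' hsum.symm
  · exact k1_ne_of_coeff_X_ne_zero hy g₁ c ρ ρ' h0 hlam hρ hρ' hsum.symm

/-- **K1 / K1′ over the residue field of record `κ(η) = 𝔽₂(Y)`** (`y = Y`, `not_isSquare_ratFuncX`): the certificate for every
regular parameter `g₁` and every tail `ρ ∈ 𝔪⁵` (`ρ = 0` for K1, `ρ = T⁸Z⁹` for the isolated variant K1′). [OURS · L1 W4.3] -/
theorem k1_not_mem_span_sup_pow_ratFunc (g₁ : MvPowerSeries (Fin 3) (RatFunc (ZMod 2)))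
    (h₁ : g₁ ∈ maximalIdeal (MvPowerSeries (Fin 3) (RatFunc (ZMod 2))))
    (h₁' : g₁ ∉ maximalIdeal (MvPowerSeries (Fin 3) (RatFunc (ZMod 2))) ^ 2)
    (ρ : MvPowerSeries (Fin 3) (RatFunc (ZMod 2))) (hρ : ρ ∈ maximalIdeal (MvPowerSeries (Fin 3) (RatFunc (ZMod 2))) ^ 5) :
    (X 1 : MvPowerSeries (Fin 3) (RatFunc (ZMod 2))) ^ 2 + C RatFunc.X * X 2 ^ 4 + C (RatFunc.X ^ 7) * X 0 ^ 4 + ρ ∉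
      Ideal.span {g₁} ⊔ maximalIdeal (MvPowerSeries (Fin 3) (RatFunc (ZMod 2))) ^ 5 := by
  haveI : Fact (Nat.Prime 2) := ⟨Nat.prime_two⟩
  exact k1_not_mem_span_sup_pow not_isSquare_ratFuncX g₁ h₁ h₁' ρ hρ

end K1Cert

end Summit.ResolutionOfSingularities.ResolutionOfSingularities.Theorems
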